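import Mathlib
import Summits.ValiantsHypothesis.ValiantsHypothesis.Theorems.LiouvilleSarnakAlignedCutRank
import Summits.ValiantsHypothesis.ValiantsHypothesis.Theorems.LiouvilleSarnakLiouvilleCutRankCertifiedCutPoints
import Literature.Computability.AlgebraicComplexity.BooleanGadgets
import HarnessLib

/-!
# Route LiouvilleSarnak — crux `LiouvilleCutRank` (stmt-ValiantsHypothesis-14775):
# prefix rows of an ARBITRARY cut are separated by RATIO WITNESSES `c/d` (not only `c/1`)

`…CertifiedCutPoints.card_le_two_pow_rank_of_certified` bounds the rank of the cut matrix
`M_π(r,c) = λ(N_π(r,c) + 1)` of ONE arbitrary cut `π` from below by `log₂ #P` for any set `P` of cut points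
whose prefix rows `r_p = 𝟙[row position < p]` are pairwise CERTIFIED: for `p < p'`, with
`m = Σ 2^{j-p}` over the row positions `j ∈ [p, p')`, a certificate is `(c, x)` with `λ(c) = -1`,
`x (c - 1) = m` and the bits of `x - 1` at column positions above `p` — then at the column
"all column bits below `p`, the bits of `x - 1` above" the two entries are `λ(2^p x)` and `λ(2^p c x)`.

This file frees the witness from the shape `c/1`:

* `prefixRows_ne_of_witness` / ★ `card_le_two_pow_rank_of_witnesses` / `le_rank_of_witnesses` — it is
  enough to give, for each pair `p < p'` in `P`, a number `Y` whose bits sit at column positions `p + b`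
  and with `λ(Y + 1 + m) ≠ λ(Y + 1)`: the entries of `r_p`, `r_{p'}` at that column are
  `λ(2^p (Y+1))`, `λ(2^p (Y+1+m))`.  (This is the exact content of "rows `r_p ≠ r_{p'}` witnessed at a
  column with all column bits below `p` set"; every arithmetic certificate is a way to KNOW the inequality.)
* `liouville_ne_of_ratio` — the general discharger: `d (Y+1+m) = c (Y+1)` with `λ(c) ≠ λ(d)` (any
  `c, d ≥ 1`) gives `λ(Y+1+m) ≠ λ(Y+1)`; `witness_of_certificate` — the tree's `(c, x)` certificates are
  the case `d = 1`, `Y = x - 1`.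
* `liouville_twelve_ne_nine`, `liouville_sixteen_ne_thirteen`, `liouville_sixteen_ne_eleven`,
  `liouville_eight_ne_one` — the small facts behind the first witnesses with `d > 1`: two ADJACENT row
  positions at `p, p+1` (`m = 3`) are crossed by `Y = 8` (a column at `p+3`; ratio `12/9 = 4/3`) or by
  `Y = 12` (columns at `p+2, p+3`; ratio `16/13`), although NO `c/1` certificate exists for `m = 3`
  (`c - 1 ∣ 3` forces `c = 2`, `x - 1 = 2` at the row position `p+1`, or `c = 4`, `λ(4) = 1`); the pattern
  `R C R C` (`m = 5`) is crossed by `Y = 10` (`16/11`), and `R R R` (`m = 7`) by `Y = 0` (`λ(8) ≠ λ(1)`).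

So the census item "bounded-run words rich in `RR`" (evidence `evidence-14775-leafhand2-g5*.md`) is not an
obstruction to separating NEIGHBOURING cut points; what no witness of this kind reaches is a pair `p < p'`
FAR apart in a generic word (`m` with many bits: `Y + 1 = d m/(c-d)` must then avoid every row position),
which is why cliques of certified cut points, hence the rank bounds of this method, stay logarithmic in the
number of LOCAL certificates.  Honest framing: a criterion for ONE cut at ONE level; `LiouvilleCutRank`,
`DigitalBilinearLiouville`, `AlgebraicSarnak` stay OPEN; nothing bears on `VP ≠ VNP`.  No definitions.
-/

set_option linter.dupNamespace false

noncomputable section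

namespace Summit.ValiantsHypothesis.ValiantsHypothesis.Theorems.LiouvilleSarnakLiouvilleCutRank.RatioWitness

open ArithmeticFunction Finset

open Summit.ValiantsHypothesis.ValiantsHypothesis.Theorems.LiouvilleSarnakAligned
  (card_image_row_le_two_pow_rank)
open Summit.ValiantsHypothesis.ValiantsHypothesis.Theorems.LiouvilleSarnakLiouvilleCutRank.CertifiedCutPoints
  (ofBits_prefix_or_shift)
open Literature.Computability.AlgebraicComplexity.BoolGadgets (ofBits_eq_sum)

/-! ### §1 Arithmetic dischargers -/

/-- `λ` does not vanish on positive integers. [folklore] -/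
theorem liouville_ne_zero' {u : ℕ} (hu : u ≠ 0) : liouville u ≠ 0 := by
  rw [liouville_apply hu]
  rcases neg_one_pow_eq_or ℤ (cardFactors u) with h | h <;> rw [h] <;> norm_num

/-- **Ratio discharger.**  If `d · v = c · u` with `u ≥ 1` and `λ(c) ≠ λ(d)`, then `λ(v) ≠ λ(u)`
(complete multiplicativity: `λ(d) λ(v) = λ(c) λ(u)`, and `λ(u) = ±1`; `c = 0` or `d = 0` cannot occur).
[folklore] -/
theorem liouville_ne_of_ratio {u v c d : ℕ} (hu : u ≠ 0)
    (h : d * v = c * u) (hcd : liouville c ≠ liouville d) : liouville v ≠ liouville u := by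
  intro hvu
  have h1 : liouville (d * v) = liouville (c * u) := by rw [h]
  rw [liouville_apply_mul, liouville_apply_mul, hvu] at h1
  have hu' : liouville u = 1 ∨ liouville u = -1 := by
    rw [liouville_apply hu]
    rcases neg_one_pow_eq_or ℤ (cardFactors u) with h2 | h2
    · left; rw [h2]
    · right; rw [h2]
  rcases hu' with h2 | h2 <;> rw [h2] at h1
  · exact hcd (by linarith)
  · exact hcd (by linarith)

/-- The tree's `(c, x)` certificates are ratio witnesses with `d = 1`, `Y = x - 1`:
`x (c - 1) = m`, `λ(c) = -1`, `x ≥ 1` give `λ((x - 1) + 1 + m) ≠ λ((x - 1) + 1)`. [folklore] -/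
theorem witness_of_certificate {c x m : ℕ} (hc : liouville c = -1) (hx : 1 ≤ x)
    (hxm : x * (c - 1) = m) : liouville (x - 1 + 1 + m) ≠ liouville (x - 1 + 1) := by
  have hc1 : 1 ≤ c := by
    rcases Nat.eq_zero_or_pos c with h0 | h0
    · rw [h0] at hc; simp at hc
    · exact h0
  have hx1 : x - 1 + 1 = x := Nat.sub_add_cancel hx
  rw [hx1]
  refine liouville_ne_of_ratio (c := c) (d := 1) (by omega) ?_ ?_
  · obtain ⟨c', rfl⟩ := Nat.exists_eq_add_of_le' hc1
    rw [Nat.add_sub_cancel] at hxm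
    rw [← hxm]; ring
  · rw [hc, liouville_apply one_ne_zero, cardFactors_one]; norm_num

/-- `λ(12) ≠ λ(9)`: the witness `Y = 8` for `m = 3` (ratio `12/9 = 4/3`). [folklore] -/
theorem liouville_twelve_ne_nine : liouville (8 + 1 + 3) ≠ liouville (8 + 1) := by
  simp [liouville_apply, cardFactors_apply, Nat.primeFactorsList_ofNat]

/-- `λ(16) ≠ λ(13)`: the witness `Y = 12` for `m = 3` (ratio `16/13`). [folklore] -/
theorem liouville_sixteen_ne_thirteen : liouville (12 + 1 + 3) ≠ liouville (12 + 1) := by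
  simp [liouville_apply, cardFactors_apply, Nat.primeFactorsList_ofNat]

/-- `λ(16) ≠ λ(11)`: the witness `Y = 10` for `m = 5` (pattern `R C R C`; ratio `16/11`). [folklore] -/
theorem liouville_sixteen_ne_eleven : liouville (10 + 1 + 5) ≠ liouville (10 + 1) := by
  simp [liouville_apply, cardFactors_apply, Nat.primeFactorsList_ofNat]

/-- `λ(8) ≠ λ(1)`: the witness `Y = 0` for `m = 7` (three consecutive row positions). [folklore] -/
theorem liouville_eight_ne_one : liouville (0 + 1 + 7) ≠ liouville (0 + 1) := by
  simp [liouville_apply, cardFactors_apply, Nat.primeFactorsList_ofNat]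

/-- There is NO `c/1` certificate for `m = 3` with the bit of `x - 1` off the row position `1`:
`x (c - 1) = 3`, `λ(c) = -1` force `(c, x) = (2, 3)`, and then `x - 1 = 2` has its bit AT position `1`.
(So adjacent row positions are out of reach of `…CertifiedCutPoints`, but not of ratio witnesses.)
[folklore] -/
theorem no_certificate_three (c x : ℕ) (hc : liouville c = -1) (hxm : x * (c - 1) = 3) :
    (x - 1).testBit 1 = true := by
  have hx : x ∣ 3 := ⟨c - 1, hxm.symm⟩
  have hx3 : x ≤ 3 := Nat.le_of_dvd (by norm_num) hx
  interval_cases x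
  · simp at hxm
  · -- x = 1: c - 1 = 3, c = 4, λ 4 = 1
    have hc4 : c = 4 := by omega
    rw [hc4] at hc
    simp [liouville_apply, cardFactors_apply, Nat.primeFactorsList_ofNat] at hc
  · omega
  · rfl

/-! ### §2 Prefix rows separated by a witness -/

/-- ★ **Witnessed cut points bound the rank from below.**  Let `π` be a cut of the `2n` bit positions
and `P` a set of cut points `p ≤ 2n` such that for every pair `p < p'` in `P` there is a WITNESS `Y`:
every bit `b` of `Y` sits at a column position `p + b`, and `λ(Y + 1 + m) ≠ λ(Y + 1)` where
`m = Σ 2^{j-p}` over the row positions `j ∈ [p, p')`.  Then `#P ≤ 2^{rank M_π}`: at the column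
"all column bits below `p`, the bits of `Y` above" the prefix rows `r_p = 𝟙[row position < p]` and
`r_{p'}` carry `λ(2^p (Y+1))` and `λ(2^p (Y+1+m))`, so they are distinct, and a `±1` matrix with `#P`
distinct rows has `#P ≤ 2^{rank}`. [this file] -/
theorem card_le_two_pow_rank_of_witnesses (n : ℕ) (π : Fin n ⊕ Fin n ≃ Fin (2 * n)) (P : Finset ℕ)
    (hP : ∀ p ∈ P, p ≤ 2 * n)
    (hwit : ∀ p ∈ P, ∀ p' ∈ P, p < p' → ∃ Y : ℕ,
      (∀ b : ℕ, Y.testBit b = true → ∃ i : Fin n, (π (Sum.inr i) : ℕ) = p + b) ∧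
      liouville (Y + 1 + ∑ j : Fin (2 * n),
        (if p ≤ (j : ℕ) ∧ (j : ℕ) < p' ∧ (π.symm j).isLeft = true then 2 ^ ((j : ℕ) - p) else 0)) ≠
        liouville (Y + 1)) :
    P.card ≤ 2 ^ (Matrix.of fun r c : Fin n → Bool =>
      (((liouville (Nat.ofBits (fun k : Fin (2 * n) => Sum.elim r c (π.symm k)) + 1) : ℤ) : ℂ))).rank := by
  classical
  set M := (Matrix.of fun r c : Fin n → Bool =>
      (((liouville (Nat.ofBits (fun k : Fin (2 * n) => Sum.elim r c (π.symm k)) + 1) : ℤ) : ℂ))) with hM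
  have hpm : ∀ r c, M r c = 1 ∨ M r c = -1 := by
    intro r c
    rw [hM, Matrix.of_apply, liouville_apply (Nat.succ_ne_zero _)]
    rcases neg_one_pow_eq_or ℤ
        (cardFactors (Nat.ofBits (fun k : Fin (2 * n) => Sum.elim r c (π.symm k)) + 1)) with h | h
    · left; rw [h]; norm_num
    · right; rw [h]; norm_num
  -- the prefix rows `r_p(i) = [π(inl i) < p]`, and their pairwise distinctness
  have hne : ∀ p ∈ P, ∀ p' ∈ P, p < p' →
      M (fun i : Fin n => decide ((π (Sum.inl i) : ℕ) < p)) ≠ M (fun i : Fin n => decide ((π (Sum.inl i) : ℕ) < p')) := by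
    intro p hp p' hp' hpp' heq
    obtain ⟨Y, hbits, hY⟩ := hwit p hp p' hp' hpp'
    set x : ℕ := Y + 1 with hxdef
    have hx : 1 ≤ x := by omega
    have hxY : x - 1 = Y := by omega
    set m : ℕ := ∑ j : Fin (2 * n),
        (if p ≤ (j : ℕ) ∧ (j : ℕ) < p' ∧ (π.symm j).isLeft = true then 2 ^ ((j : ℕ) - p) else 0) with hmdef
    have hp2 : p ≤ 2 * n := hP p hp
    have hbits' : ∀ b : ℕ, (x - 1).testBit b = true → p + b < 2 * n := fun b hb => by
      rw [hxY] at hb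
      obtain ⟨i, hi⟩ := hbits b hb
      have := (π (Sum.inr i)).2
      omega
    -- on row positions `j ≥ p` the shifted bits of `Y` vanish
    have htb : ∀ (j : Fin (2 * n)) (i : Fin n), π.symm j = Sum.inl i → p ≤ (j : ℕ) →
        (x - 1).testBit ((j : ℕ) - p) = false := by
      intro j i hj hpj
      by_contra h
      rw [Bool.not_eq_false, hxY] at h
      obtain ⟨i', hi'⟩ := hbits _ h
      have h1 : π (Sum.inr i') = j := Fin.ext (by rw [hi']; omega)
      have h2 : π.symm j = Sum.inr i' := by rw [← h1, Equiv.symm_apply_apply]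
      rw [hj] at h2
      exact Sum.inl_ne_inr h2
    -- the witness column
    set col : Fin n → Bool := fun i => decide ((π (Sum.inr i) : ℕ) < p) ||
      (x - 1).testBit ((π (Sum.inr i) : ℕ) - p) with hcol
    have hbit1 : (fun j : Fin (2 * n) => Sum.elim (fun i : Fin n => decide ((π (Sum.inl i) : ℕ) < p)) col (π.symm j)) =
        fun j : Fin (2 * n) => decide ((j : ℕ) < p) || (x - 1).testBit ((j : ℕ) - p) := by
      funext j
      rcases hj : π.symm j with i | i
      · have hji : (π (Sum.inl i) : ℕ) = j := by rw [← hj, Equiv.apply_symm_apply]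
        simp only [Sum.elim_inl, hji]
        by_cases hjp : (j : ℕ) < p
        · simp [hjp]
        · rw [htb j i hj (by omega)]
          simp [hjp]
      · have hji : (π (Sum.inr i) : ℕ) = j := by rw [← hj, Equiv.apply_symm_apply]
        simp only [Sum.elim_inr, hcol, hji]
    have hbit2 : ∀ j : Fin (2 * n),
        (Sum.elim (fun i : Fin n => decide ((π (Sum.inl i) : ℕ) < p')) col (π.symm j)).toNat =
          (decide ((j : ℕ) < p) || (x - 1).testBit ((j : ℕ) - p)).toNat +
            (if p ≤ (j : ℕ) ∧ (j : ℕ) < p' ∧ (π.symm j).isLeft = true then 1 else 0) := by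
      intro j
      rcases hj : π.symm j with i | i
      · have hji : (π (Sum.inl i) : ℕ) = j := by rw [← hj, Equiv.apply_symm_apply]
        simp only [Sum.elim_inl, hji, Sum.isLeft_inl, and_true]
        by_cases hjp : (j : ℕ) < p
        · rw [if_neg (by omega)]
          simp [hjp, show (j : ℕ) < p' by omega]
        · rw [htb j i hj (by omega)]
          by_cases hjp' : (j : ℕ) < p'
          · rw [if_pos ⟨by omega, hjp'⟩]
            simp [hjp, hjp']
          · rw [if_neg (by omega)]
            simp [hjp, hjp']
      · have hji : (π (Sum.inr i) : ℕ) = j := by rw [← hj, Equiv.apply_symm_apply]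
        simp only [Sum.elim_inr, hcol, hji, Sum.isLeft_inr]
        simp
    -- the two cut numbers
    have hN1 : Nat.ofBits (fun j : Fin (2 * n) =>
        Sum.elim (fun i : Fin n => decide ((π (Sum.inl i) : ℕ) < p)) col (π.symm j)) = 2 ^ p * x - 1 := by
      rw [hbit1, ofBits_prefix_or_shift n p x hp2 hx hbits']
    have hS1 : (∑ t : Fin (2 * n), (decide ((t : ℕ) < p) || (x - 1).testBit ((t : ℕ) - p)).toNat * 2 ^ (t : ℕ)) =
        2 ^ p * x - 1 := by
      rw [← ofBits_prefix_or_shift n p x hp2 hx hbits', ofBits_eq_sum]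
    have hS2 : (∑ t : Fin (2 * n),
        (if p ≤ (t : ℕ) ∧ (t : ℕ) < p' ∧ (π.symm t).isLeft = true then 1 else 0) * 2 ^ (t : ℕ)) =
        2 ^ p * m := by
      rw [hmdef, Finset.mul_sum]
      refine Finset.sum_congr rfl fun t _ => ?_
      by_cases h : p ≤ (t : ℕ) ∧ (t : ℕ) < p' ∧ (π.symm t).isLeft = true
      · rw [if_pos h, if_pos h, one_mul, ← pow_add, Nat.add_sub_cancel' h.1]
      · rw [if_neg h, if_neg h, zero_mul, mul_zero]
    have hN2 : Nat.ofBits (fun j : Fin (2 * n) =>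
        Sum.elim (fun i : Fin n => decide ((π (Sum.inl i) : ℕ) < p')) col (π.symm j)) =
        (2 ^ p * x - 1) + 2 ^ p * m := by
      rw [ofBits_eq_sum, ← hS1, ← hS2, ← Finset.sum_add_distrib]
      refine Finset.sum_congr rfl fun t _ => ?_
      rw [hbit2 t, add_mul]
    -- compare the two entries at `col`
    have h1 := congrFun heq col
    simp only [hM, Matrix.of_apply] at h1
    rw [hN1, hN2] at h1
    have hA : 1 ≤ 2 ^ p * x := le_trans hx (Nat.le_mul_of_pos_left x (Nat.two_pow_pos p))
    have e1 : 2 ^ p * x - 1 + 1 = 2 ^ p * x := by omega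
    have e2 : 2 ^ p * x - 1 + 2 ^ p * m + 1 = 2 ^ p * (x + m) := by
      have h3 : 2 ^ p * x - 1 + 2 ^ p * m + 1 = 2 ^ p * x + 2 ^ p * m := by omega
      rw [h3]; ring
    rw [e1, e2, Int.cast_inj, liouville_apply_mul, liouville_apply_mul] at h1
    have hne0 : liouville (2 ^ p) ≠ 0 := liouville_ne_zero' (by positivity)
    have h4 : liouville x = liouville (x + m) := mul_left_cancel₀ hne0 h1
    have h5 : x + m = Y + 1 + m := by rw [hxdef]
    rw [h5, hxdef] at h4
    exact hY h4.symm
  -- count: the prefix rows of the points of `P` are pairwise distinct rows of `M`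
  have hinj : Set.InjOn (fun p : ℕ => M (fun i : Fin n => decide ((π (Sum.inl i) : ℕ) < p))) ↑P := by
    intro p hp p' hp' h
    by_contra hpp
    rcases lt_or_gt_of_ne hpp with hlt | hlt
    · exact hne p hp p' hp' hlt h
    · exact hne p' hp' p hp hlt h.symm
  calc P.card = (P.image fun p : ℕ => M (fun i : Fin n => decide ((π (Sum.inl i) : ℕ) < p))).card :=
        (Finset.card_image_of_injOn hinj).symm
    _ ≤ (Finset.univ.image fun r : Fin n → Bool => M r).card := by
        refine Finset.card_le_card fun v hv => ?_
        obtain ⟨p, -, rfl⟩ := Finset.mem_image.mp hv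
        exact Finset.mem_image.mpr ⟨_, Finset.mem_univ _, rfl⟩
    _ ≤ 2 ^ M.rank := card_image_row_le_two_pow_rank M hpm

/-- The `W ≤ rank` form: `2^W ≤ #P` pairwise-witnessed cut points give `rank M_π ≥ W`. [this file] -/
theorem le_rank_of_witnesses (n W : ℕ) (π : Fin n ⊕ Fin n ≃ Fin (2 * n)) (P : Finset ℕ)
    (hW : 2 ^ W ≤ P.card) (hP : ∀ p ∈ P, p ≤ 2 * n)
    (hwit : ∀ p ∈ P, ∀ p' ∈ P, p < p' → ∃ Y : ℕ,
      (∀ b : ℕ, Y.testBit b = true → ∃ i : Fin n, (π (Sum.inr i) : ℕ) = p + b) ∧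
      liouville (Y + 1 + ∑ j : Fin (2 * n),
        (if p ≤ (j : ℕ) ∧ (j : ℕ) < p' ∧ (π.symm j).isLeft = true then 2 ^ ((j : ℕ) - p) else 0)) ≠
        liouville (Y + 1)) :
    W ≤ (Matrix.of fun r c : Fin n → Bool =>
      (((liouville (Nat.ofBits (fun k : Fin (2 * n) => Sum.elim r c (π.symm k)) + 1) : ℤ) : ℂ))).rank :=
  (Nat.pow_le_pow_iff_right (by norm_num)).mp
    (hW.trans (card_le_two_pow_rank_of_witnesses n π P hP hwit))

/-- **Ratio form of the criterion.**  Pairwise witnesses given as small RATIOS: for `p < p'` in `P`,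
numbers `Y, c, d` with the bits of `Y` at column positions `p + b`, `λ(c) ≠ λ(d)` and
`d (Y + 1 + m) = c (Y + 1)`.  Then `#P ≤ 2^{rank M_π}`. [this file] -/
theorem card_le_two_pow_rank_of_ratioWitnesses (n : ℕ) (π : Fin n ⊕ Fin n ≃ Fin (2 * n))
    (P : Finset ℕ) (hP : ∀ p ∈ P, p ≤ 2 * n)
    (hwit : ∀ p ∈ P, ∀ p' ∈ P, p < p' → ∃ Y c d : ℕ,
      (∀ b : ℕ, Y.testBit b = true → ∃ i : Fin n, (π (Sum.inr i) : ℕ) = p + b) ∧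
      liouville c ≠ liouville d ∧
      d * (Y + 1 + ∑ j : Fin (2 * n),
        (if p ≤ (j : ℕ) ∧ (j : ℕ) < p' ∧ (π.symm j).isLeft = true then 2 ^ ((j : ℕ) - p) else 0)) =
        c * (Y + 1)) :
    P.card ≤ 2 ^ (Matrix.of fun r c : Fin n → Bool =>
      (((liouville (Nat.ofBits (fun k : Fin (2 * n) => Sum.elim r c (π.symm k)) + 1) : ℤ) : ℂ))).rank := by
  refine card_le_two_pow_rank_of_witnesses n π P hP fun p hp p' hp' hpp' => ?_
  obtain ⟨Y, c, d, hbits, hcd, h⟩ := hwit p hp p' hp' hpp'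
  exact ⟨Y, hbits, liouville_ne_of_ratio (by omega) h hcd⟩

end Summit.ValiantsHypothesis.ValiantsHypothesis.Theorems.LiouvilleSarnakLiouvilleCutRank.RatioWitness

end
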